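import Literature.NumberTheory.Automorphic.ChevalleyGroupData
import Literature.NumberTheory.Automorphic.ChevalleyGroupTorusLie
import Literature.NumberTheory.Automorphic.ChevalleyGroupAdjoint
import Literature.NumberTheory.Automorphic.ReductiveDualChevalleyBasedProofs
import HarnessLib

/-!
# The group `G = ⟨T_X, exp (x E_α)⟩` of a family of root matrices: first properties

Trunk T-AUTOMORPHIC (G25 AutomorphicL); the group-theoretic half of Chevalley's existence theorem
(`Literature.NumberTheory.Automorphic.chevalley_existence`, Springer, *Linear Algebraic Groups*,
2nd ed., 10.1.1), step 1. Given the infinitesimal data `D : RootRep k P b J mb` of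
`ChevalleyGroupData.lean` (weights `D.wt` generating `X`, graded root matrices `D.E i` with
`[E_α, E_{-α}] = H_α`, the Lie algebra `D.lie = 𝔱_V + ∑ k E_α`) we form, inside
`GL V = GL (Σ j, mb j) k`, the weight torus `D.T = T_X` (`WeightTorus.lean`), the one-parameter
unipotent groups `D.U i = {exp (x E_α)}` (`NilpotentExpRootHom.lean`) and **the group
`D.G = ⟨T, U_α : α ∈ R⟩`** (Springer 10.2.7), and prove:

* `D.G` is a Zariski-connected algebraic subgroup (Springer 2.2.7 (i), `isZConnected_iSup`);
  `T` acts on `E_α` through the character `α` (`conj_E`), so `x ↦ exp (x E_α)` is a root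
  homomorphism and `U_α` is connected (`IsRootHom.isZConnected_range`);
* **`𝔤_V ≤ Lie(G)`** (`lie_le_lieAlgebraGL`): `E_α ∈ Lie(G)` as the velocity of `exp (x E_α)`
  (`mem_lieAlgebraGL_of_expHom_mem`) and `𝔱_V = Lie(T_X) ≤ Lie(G)`
  (`lieAlgebraGL_weightTorus_eq`);
* **`G` normalises `𝔤_V`** (`conj_mem_lie`): `𝔤_V` is stable under `ad E_α` and under `Ad(T)`,
  hence under `Ad (exp (x E_α)) = exp (x ad E_α)` (`expHom_conj_mem`) and under all of `G`;
  consequently **`[Lie(G), 𝔤_V] ⊆ 𝔤_V`** (`lie_mem_lie_of_mem_lieAlgebraGL`, by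
  `lie_mem_of_forall_conj_mem`, Springer 4.4.15);
* **block structure**: `G` consists of block-diagonal matrices (`apply_of_fst_ne`), so does
  `Lie(G)`, and for every integer relation `∑ v_j w_j = 0` among the block weight sums
  `w_j = ∑_{a ∈ block j} wt a` the character `g ↦ ∏_j det (g|_{V_j}) ^ {v_j}` is trivial on `G`
  (it kills the unipotent `U_α`, `det exp = 1`, and is `χ (∑ v_j w_j) = 1` on `T_X`); its
  differential gives the **trace relations `∑_j v_j tr (A|_{V_j}) = 0` on `Lie(G)`**
  (`sum_trace_blockDiag_eq_zero`).

The computation `Lie(G) = 𝔤_V` and the structure of `G` follow in `ChevalleyGroupLie.lean`.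

## Mathlib

`Matrix.blockDiagonal'`, `Matrix.blockDiag'` (`_blockDiagonal'`, `_map`, `_one`, `_diagonal`),
`Fintype.sum_sigma`, `IsNilpotent.exp_eq_sum`, `MvPolynomial.vanishingIdeal`, `RingHom.map_det`.
Nothing here duplicates a Mathlib declaration.

## References

* [SpringerLAG1998] T. A. Springer, *Linear Algebraic Groups*, 2nd ed. (1998): 2.2.7, 4.4.15,
  10.1.1, 10.2.7–10.2.8.
* R. Steinberg, *Lectures on Chevalley groups*, Yale (1968), §3, §5.
-/

noncomputable section

open scoped MatrixGroups
open MvPolynomial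

namespace Literature.NumberTheory.Automorphic

attribute [local instance 100] LieRing.ofAssociativeRing

variable {k : Type*} [Field k]
variable {ι X Y : Type*} [AddCommGroup X] [AddCommGroup Y]
variable {J : Type*} [Fintype J] [DecidableEq J] {mb : J → Type*} [∀ j, Fintype (mb j)]
  [∀ j, DecidableEq (mb j)]
variable {P : RootPairing ι ℤ X Y} {b : P.Base}

namespace RootRep

variable (D : RootRep k P b J mb)

local notation "𝕄" => Matrix (Σ j, mb j) (Σ j, mb j) k

/-! ### The torus -/

/-- The weight torus `T = T_X ≤ GL(V)` of the family (Springer 10.2.7: the torus with character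
group `X` acting through the weights); an `abbrev` for `weightTorus k D.wt`, so that the
character/cocharacter lattices and the commutativity instance of `WeightTorus.lean` apply
verbatim. [folklore] -/
abbrev T : Subgroup (GL (Σ j, mb j) k) := weightTorus k D.wt

/-- Unfolding of `T`. [folklore] -/
lemma T_def : D.T = weightTorus k D.wt := rfl

/-- Elements of `T` and their inverses are the diagonal matrices of a character of `X`. [folklore] -/
lemma exists_coe_T_eq (t : ↥D.T) : ∃ χ : Multiplicative X →* kˣ,
    ((t : GL (Σ j, mb j) k) : 𝕄) = Matrix.diagonal (fun a => (χ (Multiplicative.ofAdd (D.wt a)) : k)) ∧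
      (((t : GL (Σ j, mb j) k)⁻¹ : GL (Σ j, mb j) k) : 𝕄) =
        Matrix.diagonal (fun a => (((χ (Multiplicative.ofAdd (D.wt a)))⁻¹ : kˣ) : k)) ∧
      charOfMem k D.wt_surjective t = χ := by
  obtain ⟨g, hg⟩ := t
  obtain ⟨χ, rfl⟩ := hg
  refine ⟨χ, ?_, ?_, charOfMem_weightTorusHom _ χ⟩
  · change ((weightTorusHom k D.wt χ : GL (Σ j, mb j) k) : 𝕄) = _
    rw [weightTorusHom_apply, coe_diagonalGL]
  · change (((weightTorusHom k D.wt χ)⁻¹ : GL (Σ j, mb j) k) : 𝕄) = _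
    rw [← map_inv, weightTorusHom_apply, coe_diagonalGL]
    rfl

/-- **`T` acts on a homogeneous matrix of degree `ξ` through the character `ξ`.** [folklore] -/
lemma conj_of_isHomogMat (t : ↥D.T) {ξ : X} {A : 𝕄} (hA : IsHomogMat D.wt ξ A) :
    ((t : GL (Σ j, mb j) k) : 𝕄) * A * (((t : GL (Σ j, mb j) k)⁻¹ : GL (Σ j, mb j) k) : 𝕄) =
      ((evalChar k D.wt_surjective ξ t : kˣ) : k) • A := by
  obtain ⟨χ, h1, h2, h3⟩ := D.exists_coe_T_eq t
  rw [h1, h2, diagonal_mul_mul_diagonal_inv_of_isHomogMat hA, evalChar_apply, h3]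

/-- **`T` acts on `E_α` through `α`**: `t E_α t⁻¹ = α(t) E_α` with `α = evalChar (P.root i)`
(Springer 10.2.7: `t . e_α = α(t) e_α`). [folklore] -/
lemma conj_E (i : ι) (t : ↥D.T) :
    ((t : GL (Σ j, mb j) k) : 𝕄) * D.E i * (((t : GL (Σ j, mb j) k)⁻¹ : GL (Σ j, mb j) k) : 𝕄) =
      ((evalChar k D.wt_surjective (P.root i) t : kˣ) : k) • D.E i :=
  D.conj_of_isHomogMat t (D.isHomogMat_E i)

/-- **`T` is Zariski-connected.** [folklore] -/
lemma isZConnected_T [IsAlgClosed k] [Module.Free ℤ X] : IsZConnected D.T :=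
  isZConnected_weightTorus (k := k) D.wt_surjective

/-- `T` is a torus. [folklore] -/
lemma isTorusSubgroup_T [IsAlgClosed k] [Module.Free ℤ X] : IsTorusSubgroup D.T :=
  isTorusSubgroup_weightTorus D.wt_surjective

/-! ### `T` normalises `𝔤_V`, and `𝔤_V` is stable under `ad E_α` -/

/-- `𝔤_V` is stable under `ad E_α`. [folklore] -/
lemma E_mul_sub_mul_E_mem_lie (i : ι) {M : 𝕄} (hM : M ∈ D.lie) :
    D.E i * M - M * D.E i ∈ D.lie := by
  obtain ⟨D₀, hD₀, S, hS, rfl⟩ := Submodule.mem_sup.1 hM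
  clear hM
  rw [Matrix.mul_add, Matrix.add_mul, add_sub_add_comm]
  refine D.lie.add_mem ?_ ?_
  · -- `[E_α, D_ℓ] = -ℓ(α) E_α`
    obtain ⟨ℓ, rfl⟩ := hD₀
    rw [torusDiagLin_apply, ← neg_sub, torusDiag_mul_sub_mul_torusDiag (D.isHomogMat_E i)]
    exact D.lie.neg_mem (D.lie.smul_mem _ (D.E_mem_lie i))
  · induction hS using Submodule.span_induction with
    | mem S hS =>
      obtain ⟨i', rfl⟩ := hS
      exact D.E_mul_E_sub_mem i i'
    | zero => simp
    | add S S' _ _ h h' =>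
      rw [Matrix.mul_add, Matrix.add_mul, add_sub_add_comm]
      exact D.lie.add_mem h h'
    | smul c S _ h =>
      rw [Matrix.mul_smul, Matrix.smul_mul, ← smul_sub]
      exact D.lie.smul_mem c h

/-- The subgroup of `GL(V)` of elements `g` with `g 𝔤_V g⁻¹ ⊆ 𝔤_V` and `g⁻¹ 𝔤_V g ⊆ 𝔤_V`.
[folklore] -/
def lieStabilizer : Subgroup (GL (Σ j, mb j) k) where
  carrier := {g | ∀ M ∈ D.lie,
    (g : 𝕄) * M * ((g⁻¹ : GL (Σ j, mb j) k) : 𝕄) ∈ D.lie ∧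
    ((g⁻¹ : GL (Σ j, mb j) k) : 𝕄) * M * (g : 𝕄) ∈ D.lie}
  one_mem' M hM := by simpa using hM
  mul_mem' {g h} hg hh M hM := by
    refine ⟨?_, ?_⟩
    · have h1 := (hg _ (hh M hM).1).1
      simp only [mul_inv_rev, Units.val_mul] at h1 ⊢
      simpa only [Matrix.mul_assoc] using h1
    · have h1 := (hh _ (hg M hM).2).2
      simp only [mul_inv_rev, Units.val_mul] at h1 ⊢
      simpa only [Matrix.mul_assoc] using h1
  inv_mem' {g} hg M hM := by
    rw [inv_inv]
    exact ⟨(hg M hM).2, (hg M hM).1⟩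

/-- Membership in `lieStabilizer`. [folklore] -/
lemma mem_lieStabilizer_iff {g : GL (Σ j, mb j) k} : g ∈ D.lieStabilizer ↔ ∀ M ∈ D.lie,
    (g : 𝕄) * M * ((g⁻¹ : GL (Σ j, mb j) k) : 𝕄) ∈ D.lie ∧
    ((g⁻¹ : GL (Σ j, mb j) k) : 𝕄) * M * (g : 𝕄) ∈ D.lie :=
  Iff.rfl

/-- Conjugation of an element of `𝔤_V` by a torus element stays in `𝔤_V`. [folklore] -/
lemma conj_T_mem_lie (t : ↥D.T) {M : 𝕄} (hM : M ∈ D.lie) :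
    ((t : GL (Σ j, mb j) k) : 𝕄) * M * (((t : GL (Σ j, mb j) k)⁻¹ : GL (Σ j, mb j) k) : 𝕄) ∈ D.lie := by
  obtain ⟨D₀, hD₀, S, hS, rfl⟩ := Submodule.mem_sup.1 hM
  clear hM
  rw [Matrix.mul_add, Matrix.add_mul]
  refine D.lie.add_mem ?_ ?_
  · obtain ⟨ℓ, rfl⟩ := hD₀
    rw [torusDiagLin_apply, D.conj_of_isHomogMat t (isHomogMat_torusDiag ℓ)]
    exact D.lie.smul_mem _ (D.torusDiag_mem_lie ℓ)
  · induction hS using Submodule.span_induction with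
    | mem S hS =>
      obtain ⟨i', rfl⟩ := hS
      rw [D.conj_E i' t]
      exact D.lie.smul_mem _ (D.E_mem_lie i')
    | zero => simp
    | add S S' _ _ h h' =>
      rw [Matrix.mul_add, Matrix.add_mul]
      exact D.lie.add_mem h h'
    | smul c S _ h =>
      rw [Matrix.mul_smul, Matrix.smul_mul]
      exact D.lie.smul_mem c h

/-- `T` normalises `𝔤_V`. [folklore] -/
lemma T_le_lieStabilizer : D.T ≤ D.lieStabilizer := by
  intro t ht M hM
  refine ⟨D.conj_T_mem_lie ⟨t, ht⟩ hM, ?_⟩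
  have h := D.conj_T_mem_lie ⟨t⁻¹, D.T.inv_mem ht⟩ hM
  simpa using h

/-! ### Block-diagonal matrices -/

omit [∀ j, DecidableEq (mb j)] in
/-- Products with a block-diagonal matrix on the right, block by block. [folklore] -/
lemma mul_blockDiagonal'_apply (A : 𝕄) (M : ∀ j, Matrix (mb j) (mb j) k) (x y : Σ j, mb j) :
    (A * Matrix.blockDiagonal' M) x y = ∑ c, A x ⟨y.1, c⟩ * M y.1 c y.2 := by
  rcases y with ⟨j₀, c₀⟩
  rw [Matrix.mul_apply, Fintype.sum_sigma, Finset.sum_eq_single j₀]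
  · exact Finset.sum_congr rfl fun c _ => by rw [Matrix.blockDiagonal'_apply_eq]
  · intro j _ hj
    refine Finset.sum_eq_zero fun c _ => ?_
    rw [Matrix.blockDiagonal'_apply_ne M _ _ hj, mul_zero]
  · intro h; exact (h (Finset.mem_univ _)).elim

omit [∀ j, DecidableEq (mb j)] in
/-- Products with a block-diagonal matrix on the left, block by block. [folklore] -/
lemma blockDiagonal'_mul_apply (A : 𝕄) (M : ∀ j, Matrix (mb j) (mb j) k) (x y : Σ j, mb j) :
    (Matrix.blockDiagonal' M * A) x y = ∑ c, M x.1 x.2 c * A ⟨x.1, c⟩ y := by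
  rcases x with ⟨j₀, a₀⟩
  rw [Matrix.mul_apply, Fintype.sum_sigma, Finset.sum_eq_single j₀]
  · exact Finset.sum_congr rfl fun c _ => by rw [Matrix.blockDiagonal'_apply_eq]
  · intro j _ hj
    refine Finset.sum_eq_zero fun c _ => ?_
    rw [Matrix.blockDiagonal'_apply_ne M a₀ c (Ne.symm hj), zero_mul]
  · intro h; exact (h (Finset.mem_univ _)).elim

/-- A matrix is *block diagonal* if its entries between different blocks vanish. [folklore] -/
def IsBlockDiag (A : 𝕄) : Prop := ∀ x y, x.1 ≠ y.1 → A x y = 0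

omit [Fintype J] [∀ j, Fintype (mb j)] [∀ j, DecidableEq (mb j)] in
/-- A block-diagonal matrix is `blockDiagonal'` of its diagonal blocks. [folklore] -/
lemma IsBlockDiag.eq_blockDiagonal' {A : 𝕄} (hA : IsBlockDiag A) :
    A = Matrix.blockDiagonal' (Matrix.blockDiag' A) := by
  ext ⟨j, a⟩ ⟨j', c⟩
  by_cases h : j = j'
  · subst h
    rw [Matrix.blockDiagonal'_apply_eq, Matrix.blockDiag'_apply]
  · rw [Matrix.blockDiagonal'_apply_ne _ _ _ h, hA _ _ h]

omit [Fintype J] [∀ j, Fintype (mb j)] [∀ j, DecidableEq (mb j)] in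
/-- `blockDiagonal'` matrices are block diagonal. [folklore] -/
lemma isBlockDiag_blockDiagonal' (M : ∀ j, Matrix (mb j) (mb j) k) :
    IsBlockDiag (Matrix.blockDiagonal' M : 𝕄) := fun _ _ h => Matrix.blockDiagonal'_apply_ne M _ _ h

omit [∀ j, DecidableEq (mb j)] in
/-- Products of block-diagonal matrices, block by block. [folklore] -/
lemma IsBlockDiag.blockDiag'_mul {A B : 𝕄} (hA : IsBlockDiag A) (hB : IsBlockDiag B) (j : J) :
    Matrix.blockDiag' (A * B) j = Matrix.blockDiag' A j * Matrix.blockDiag' B j := by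
  conv_lhs => rw [hA.eq_blockDiagonal', hB.eq_blockDiagonal', ← Matrix.blockDiagonal'_mul]
  rw [Matrix.blockDiag'_blockDiagonal']

omit [∀ j, DecidableEq (mb j)] in
/-- Products of block-diagonal matrices are block diagonal. [folklore] -/
lemma IsBlockDiag.mul {A B : 𝕄} (hA : IsBlockDiag A) (hB : IsBlockDiag B) : IsBlockDiag (A * B) := by
  rw [hA.eq_blockDiagonal', hB.eq_blockDiagonal', ← Matrix.blockDiagonal'_mul]
  exact isBlockDiag_blockDiagonal' _

/-- The root matrices are block diagonal. [folklore] -/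
lemma isBlockDiag_E (i : ι) : IsBlockDiag (D.E i) := isBlockDiag_blockDiagonal' _

/-- Powers of the root matrices. [folklore] -/
lemma E_pow (i : ι) (r : ℕ) : D.E i ^ r = Matrix.blockDiagonal' fun j => (D.blk j).E i ^ r :=
  (Matrix.blockDiagonal'_pow (fun j => (D.blk j).E i) r).symm

/-- The subgroup of block-diagonal invertible matrices (with block-diagonal inverse). [folklore] -/
def blockDiagSubgroup : Subgroup (GL (Σ j, mb j) k) where
  carrier := {g | IsBlockDiag (g : 𝕄) ∧ IsBlockDiag ((g⁻¹ : GL (Σ j, mb j) k) : 𝕄)}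
  one_mem' := by
    refine ⟨fun x y h => ?_, fun x y h => ?_⟩ <;>
      simp [Matrix.one_apply_ne (fun hxy => h (congrArg Sigma.fst hxy))]
  mul_mem' {g h} hg hh := by
    refine ⟨?_, ?_⟩
    · rw [Units.val_mul]; exact hg.1.mul hh.1
    · rw [mul_inv_rev, Units.val_mul]; exact hh.2.mul hg.2
  inv_mem' {g} hg := by
    refine ⟨hg.2, ?_⟩
    rw [inv_inv]; exact hg.1

/-- `T` is block diagonal (it is diagonal). [folklore] -/
lemma T_le_blockDiagSubgroup : D.T ≤ blockDiagSubgroup := by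
  intro t ht
  obtain ⟨χ, h1, h2, -⟩ := D.exists_coe_T_eq ⟨t, ht⟩
  refine ⟨fun x y h => ?_, fun x y h => ?_⟩
  · change (((⟨t, ht⟩ : ↥D.T) : GL (Σ j, mb j) k) : 𝕄) x y = 0
    rw [h1, Matrix.diagonal_apply_ne _ (fun hxy => h (congrArg Sigma.fst hxy))]
  · change ((((⟨t, ht⟩ : ↥D.T) : GL (Σ j, mb j) k)⁻¹ : GL (Σ j, mb j) k) : 𝕄) x y = 0
    rw [h2, Matrix.diagonal_apply_ne _ (fun hxy => h (congrArg Sigma.fst hxy))]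

/-! ### Block weight sums, block determinants -/

/-- The block weight sum `w_j = ∑_{a ∈ block j} wt a ∈ X`. [folklore] -/
def blockWt (j : J) : X := ∑ a : mb j, (D.blk j).wt a

/-- Unfolding of `blockWt`. [folklore] -/
lemma blockWt_def (j : J) : D.blockWt j = ∑ a : mb j, (D.blk j).wt a := rfl

/-- The block weight sums are orthogonal to all coroots. [folklore] -/
lemma blockWt_coroot (j : J) (i : ι) : P.toLinearMap (D.blockWt j) (P.coroot i) = 0 :=
  (D.blk j).sum_wt_coroot i

/-- The determinant of the `j`-th diagonal block, as a polynomial in the coordinates of `GL(V)`.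
[folklore] -/
def blockDetPoly (j : J) : MvPolynomial (GLCoord (Σ j, mb j)) k :=
  (Matrix.blockDiag' (genericMatrixGL (Σ j, mb j) k) j).det

/-- Evaluation of the block determinant polynomial. [folklore] -/
lemma eval_blockDetPoly (j : J) (g : GL (Σ j, mb j) k) :
    MvPolynomial.eval (glCoordFun g) (blockDetPoly (k := k) (mb := mb) j) =
      (Matrix.blockDiag' (g : 𝕄) j).det := by
  rw [blockDetPoly, RingHom.map_det, RingHom.mapMatrix_apply,
    ← congrFun (Matrix.blockDiag'_map (genericMatrixGL (Σ j, mb j) k) _) j,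
    ← RingHom.mapMatrix_apply, eval_mapMatrix_genericMatrixGL]

/-- The block determinant polynomial at the point `1 + ε A`: `1 + ε tr (A|_{V_j})`. [folklore] -/
lemma aeval_dualPoint_blockDetPoly (j : J) (A : 𝕄) :
    MvPolynomial.aeval (dualPoint A) (blockDetPoly (k := k) (mb := mb) j) =
      TrivSqZeroExt.inl 1 + TrivSqZeroExt.inr (Matrix.trace (Matrix.blockDiag' A j)) := by
  rw [blockDetPoly]
  have h := aeval_dualPoint_mapMatrix_genericMatrixGL A
  rw [AlgHom.map_det, AlgHom.mapMatrix_apply,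
    ← congrFun (Matrix.blockDiag'_map (genericMatrixGL (Σ j, mb j) k) _) j]
  have h' : (genericMatrixGL (Σ j, mb j) k).map (MvPolynomial.aeval (dualPoint A)) =
      dualMatrix A := by
    rw [← h]; rfl
  rw [h', dualMatrix, Matrix.blockDiag'_add, Matrix.blockDiag'_one, Pi.add_apply, Pi.one_apply,
    congrFun (Matrix.blockDiag'_map A _) j, ← dualMatrix, det_dualMatrix]

/-- The block determinant polynomial has value `1` at `1`. [folklore] -/
lemma eval_one_blockDetPoly (j : J) :
    MvPolynomial.eval (glCoordFun (1 : GL (Σ j, mb j) k)) (blockDetPoly (k := k) (mb := mb) j) = 1 := by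
  rw [eval_blockDetPoly, Units.val_one, Matrix.blockDiag'_one, Pi.one_apply, Matrix.det_one]

/-- **The differential of the block determinant is the block trace**: `d (det_j)_1 (A) = tr (A|_{V_j})`.
[folklore] -/
lemma tangentDeriv_blockDetPoly (j : J) (A : 𝕄) :
    tangentDeriv (blockDetPoly (k := k) (mb := mb) j) A = Matrix.trace (Matrix.blockDiag' A j) := by
  rw [tangentDeriv, aeval_dualPoint_blockDetPoly]
  simp

/-- The block determinant character `g ↦ ∏_j det (g|_{V_j}) ^ {v_j}` of an integer vector `v`.
[folklore] -/
def blockDetChar (v : J → ℤ) (g : GL (Σ j, mb j) k) : k :=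
  ∏ j, (Matrix.blockDiag' (g : 𝕄) j).det ^ v j

/-- Unfolding of `blockDetChar`. [folklore] -/
lemma blockDetChar_def (v : J → ℤ) (g : GL (Σ j, mb j) k) : blockDetChar v g =
    ∏ j, (Matrix.blockDiag' (g : 𝕄) j).det ^ v j := rfl

/-- The block determinant character is multiplicative on block-diagonal matrices. [folklore] -/
lemma blockDetChar_mul (v : J → ℤ) {g h : GL (Σ j, mb j) k} (hg : g ∈ blockDiagSubgroup)
    (hh : h ∈ blockDiagSubgroup) : blockDetChar v (g * h) = blockDetChar v g * blockDetChar v h := by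
  rw [blockDetChar, blockDetChar, blockDetChar, ← Finset.prod_mul_distrib]
  refine Finset.prod_congr rfl fun j _ => ?_
  rw [Units.val_mul, IsBlockDiag.blockDiag'_mul hg.1 hh.1, Matrix.det_mul, mul_zpow]

/-- The block determinants of an invertible block-diagonal matrix are non-zero. [folklore] -/
lemma det_blockDiag'_ne_zero {g : GL (Σ j, mb j) k} (hg : g ∈ blockDiagSubgroup) (j : J) :
    (Matrix.blockDiag' (g : 𝕄) j).det ≠ 0 := by
  have h1 : Matrix.blockDiag' (g : 𝕄) j * Matrix.blockDiag' ((g⁻¹ : GL (Σ j, mb j) k) : 𝕄) j = 1 := by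
    rw [← IsBlockDiag.blockDiag'_mul hg.1 hg.2, ← Units.val_mul, mul_inv_cancel, Units.val_one,
      Matrix.blockDiag'_one, Pi.one_apply]
  intro h0
  have := congrArg Matrix.det h1
  rw [Matrix.det_mul, h0, zero_mul, Matrix.det_one] at this
  exact zero_ne_one this

/-- The kernel of the block determinant character inside the block-diagonal group. [folklore] -/
def blockDetKer (v : J → ℤ) : Subgroup (GL (Σ j, mb j) k) where
  carrier := {g | g ∈ blockDiagSubgroup ∧ blockDetChar v g = 1}
  one_mem' := ⟨blockDiagSubgroup.one_mem, by
    simp [blockDetChar, Matrix.blockDiag'_one]⟩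
  mul_mem' {g h} hg hh := ⟨blockDiagSubgroup.mul_mem hg.1 hh.1, by
    rw [blockDetChar_mul v hg.1 hh.1, hg.2, hh.2, one_mul]⟩
  inv_mem' {g} hg := by
    refine ⟨blockDiagSubgroup.inv_mem hg.1, ?_⟩
    have h := blockDetChar_mul v hg.1 (blockDiagSubgroup.inv_mem hg.1)
    rw [mul_inv_cancel, hg.2, one_mul] at h
    rw [← h]
    simp [blockDetChar, Matrix.blockDiag'_one]

/-- **The block determinant character of a relation among the block weight sums is trivial on
`T`**: `∏_j det (t|_{V_j}) ^ {v_j} = χ_t (∑ v_j w_j) = 1`. [folklore] -/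
lemma T_le_blockDetKer {v : J → ℤ} (hv : ∑ j, v j • D.blockWt j = 0) : D.T ≤ blockDetKer v := by
  intro t ht
  refine ⟨D.T_le_blockDiagSubgroup ht, ?_⟩
  obtain ⟨χ, h1, -, -⟩ := D.exists_coe_T_eq ⟨t, ht⟩
  change blockDetChar v ((⟨t, ht⟩ : ↥D.T) : GL (Σ j, mb j) k) = 1
  rw [blockDetChar_def, h1]
  have hblk : ∀ j, Matrix.blockDiag' (Matrix.diagonal fun a : Σ j, mb j =>
      (χ (Multiplicative.ofAdd (D.wt a)) : k)) j =
        Matrix.diagonal fun a : mb j => (χ (Multiplicative.ofAdd ((D.blk j).wt a)) : k) := fun j =>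
    Matrix.blockDiag'_diagonal (fun a : Σ j, mb j => (χ (Multiplicative.ofAdd (D.wt a)) : k)) j
  simp_rw [hblk, Matrix.det_diagonal]
  -- `∏_a χ (wt a) = χ (w_j)` and `∏_j χ(w_j) ^ v_j = χ (∑ v_j w_j) = 1`
  have hj : ∀ j, ∏ a : mb j, (χ (Multiplicative.ofAdd ((D.blk j).wt a)) : k) =
      (χ (Multiplicative.ofAdd (D.blockWt j)) : k) := by
    intro j
    rw [blockWt_def, ofAdd_sum, map_prod, Units.coe_prod]
  simp_rw [hj, ← Units.val_zpow_eq_zpow_val, ← Units.coe_prod]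
  rw [Units.val_eq_one]
  calc ∏ j, χ (Multiplicative.ofAdd (D.blockWt j)) ^ v j
      = χ (Multiplicative.ofAdd (∑ j, v j • D.blockWt j)) := by
        rw [ofAdd_sum, map_prod]
        exact Finset.prod_congr rfl fun j _ => by rw [ofAdd_zsmul, map_zpow]
    _ = 1 := by rw [hv, ofAdd_zero, map_one]

/-- The polynomial `∏_j det_j ^ {v_j⁺} - ∏_j det_j ^ {v_j⁻}` expressing the triviality of the block
determinant character of `v`. [folklore] -/
def blockDetRelPoly (v : J → ℤ) : MvPolynomial (GLCoord (Σ j, mb j)) k :=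
  ∏ j, blockDetPoly (k := k) (mb := mb) j ^ (v j).toNat -
    ∏ j, blockDetPoly (k := k) (mb := mb) j ^ (-v j).toNat

/-- The relation polynomial vanishes on the kernel of the block determinant character. [folklore] -/
lemma eval_blockDetRelPoly_eq_zero {v : J → ℤ} {g : GL (Σ j, mb j) k} (hg : g ∈ blockDetKer v) :
    MvPolynomial.eval (glCoordFun g) (blockDetRelPoly (k := k) (mb := mb) v) = 0 := by
  obtain ⟨hgb, hgv⟩ := hg
  simp only [blockDetRelPoly, map_sub, map_prod, map_pow, eval_blockDetPoly, sub_eq_zero]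
  rw [blockDetChar_def] at hgv
  have h2 : ∀ j, (Matrix.blockDiag' (g : 𝕄) j).det ^ v j =
      (Matrix.blockDiag' (g : 𝕄) j).det ^ (v j).toNat *
        ((Matrix.blockDiag' (g : 𝕄) j).det ^ (-v j).toNat)⁻¹ := by
    intro j
    rw [← zpow_natCast, ← zpow_natCast, ← zpow_neg, ← zpow_add₀ (det_blockDiag'_ne_zero hgb j),
      ← sub_eq_add_neg, toNat_sub_toNat_neg_eq]
  simp_rw [h2] at hgv
  rw [Finset.prod_mul_distrib, Finset.prod_inv_distrib, mul_inv_eq_one₀] at hgv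
  · exact hgv
  · exact Finset.prod_ne_zero_iff.2 fun j _ => pow_ne_zero _ (det_blockDiag'_ne_zero hgb j)

/-! ### The root groups and the group `G` -/

section Group

variable [CharZero k]

/-- The one-parameter unipotent group `U_α = {exp (x E_α)}` of the root `α = P.root i`
(Springer 10.2.7). [folklore] -/
def U (i : ι) : Subgroup (GL (Σ j, mb j) k) := (expHom (D.E i) (D.isNilpotent_E i)).range

/-- **The group `G = ⟨T, U_α : α ∈ R⟩ ≤ GL(V)`** of the family (Springer 10.2.7). [folklore] -/
def G : Subgroup (GL (Σ j, mb j) k) := D.T ⊔ ⨆ i, D.U i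

/-- Unfolding of `U`. [folklore] -/
lemma U_def (i : ι) : D.U i = (expHom (D.E i) (D.isNilpotent_E i)).range := rfl

/-- Unfolding of `G`. [folklore] -/
lemma G_def : D.G = D.T ⊔ ⨆ i, D.U i := rfl

/-- `T ≤ G`. [folklore] -/
lemma T_le_G : D.T ≤ D.G := le_sup_left

/-- `U_α ≤ G`. [folklore] -/
lemma U_le_G (i : ι) : D.U i ≤ D.G := (le_iSup D.U i).trans le_sup_right

/-- `exp (x E_α) ∈ G`. [folklore] -/
lemma expHom_mem_G (i : ι) (x : Multiplicative k) : expHom (D.E i) (D.isNilpotent_E i) x ∈ D.G :=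
  D.U_le_G i ⟨x, rfl⟩

/-- `x ↦ exp (x E_α)` is a root homomorphism of `GL(V)` relative to `T` with character `α`.
[folklore] -/
lemma isRootHom_expHom_top (i : ι) :
    IsRootHom ⊤ D.T le_top (evalChar k D.wt_surjective (P.root i))
      ((expHom (D.E i) (D.isNilpotent_E i)).codRestrict ⊤ fun _ => Subgroup.mem_top _) :=
  isRootHom_codRestrict_expHom le_top (D.isNilpotent_E i) (D.E_ne_zero i) _ (D.conj_E i)

/-- **`U_α` is Zariski-connected** (as the image of a root homomorphism, Springer 8.1.1 (i)).
[folklore] -/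
lemma isZConnected_U [Infinite k] (i : ι) : IsZConnected (D.U i) := by
  have h := (D.isRootHom_expHom_top i).isZConnected_range
  convert h using 1
  ext g
  simp only [U_def, MonoidHom.mem_range, Subgroup.mem_map, MonoidHom.codRestrict_apply,
    Subgroup.coe_subtype, exists_exists_eq_and]

/-- **`G` is Zariski-connected** (Springer 2.2.7 (i)). [cite: SpringerLAG1998, 10.2.7 with 2.2.7 (i)] -/
theorem isZConnected_G [IsAlgClosed k] [Module.Free ℤ X] : IsZConnected D.G :=
  isZConnected_sup D.isZConnected_T (isZConnected_iSup D.U D.isZConnected_U)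

/-- `G` is an algebraic subgroup. [folklore] -/
theorem isAlgebraicSubgroup_G [IsAlgClosed k] [Module.Free ℤ X] : IsAlgebraicSubgroup D.G :=
  D.isZConnected_G.1

/-! ### `𝔤_V ≤ Lie(G)` -/

/-- **`E_α ∈ Lie(G)`** (the velocity of `x ↦ exp (x E_α) ∈ G`). [folklore] -/
lemma E_mem_lieAlgebraGL (i : ι) : D.E i ∈ lieAlgebraGL D.G :=
  mem_lieAlgebraGL_of_expHom_mem (D.isNilpotent_E i) (D.expHom_mem_G i)

/-- **`𝔱_V ≤ Lie(G)`** (`𝔱_V = Lie(T)` and `T ≤ G`). [folklore] -/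
lemma torusLie_le_lieAlgebraGL [IsAlgClosed k] [Module.Free ℤ X] [Module.Finite ℤ X] :
    torusLie (k := k) D.wt ≤ lieAlgebraGL D.G := by
  rw [← lieAlgebraGL_weightTorus_eq D.wt_surjective]
  exact lieAlgebraGL_mono D.T_le_G

/-- **`𝔤_V ≤ Lie(G)`.** [folklore] -/
theorem lie_le_lieAlgebraGL [IsAlgClosed k] [Module.Free ℤ X] [Module.Finite ℤ X] :
    D.lie ≤ lieAlgebraGL D.G :=
  sup_le D.torusLie_le_lieAlgebraGL (Submodule.span_le.2 (by
    rintro _ ⟨i, rfl⟩; exact D.E_mem_lieAlgebraGL i))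

/-! ### `G` normalises `𝔤_V` -/

/-- `U_α` normalises `𝔤_V` (`Ad (exp (x E_α)) = exp (x ad E_α)`). [folklore] -/
lemma U_le_lieStabilizer (i : ι) : D.U i ≤ D.lieStabilizer := by
  rintro _ ⟨x, rfl⟩ M hM
  refine ⟨expHom_conj_mem (D.isNilpotent_E i) (fun M' hM' => D.E_mul_sub_mul_E_mem_lie i hM') hM x,
    ?_⟩
  have h := expHom_conj_mem (D.isNilpotent_E i) (fun M' hM' => D.E_mul_sub_mul_E_mem_lie i hM')
    hM x⁻¹
  rwa [map_inv, inv_inv] at h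

/-- **`G` normalises `𝔤_V`**: `g M g⁻¹ ∈ 𝔤_V` for `g ∈ G`, `M ∈ 𝔤_V` (Springer 10.2.8: `G` is a
group of automorphisms of `𝔤`). [folklore] -/
theorem conj_mem_lie {g : GL (Σ j, mb j) k} (hg : g ∈ D.G) {M : 𝕄} (hM : M ∈ D.lie) :
    (g : 𝕄) * M * ((g⁻¹ : GL (Σ j, mb j) k) : 𝕄) ∈ D.lie := by
  have hle : D.G ≤ D.lieStabilizer := sup_le D.T_le_lieStabilizer (iSup_le D.U_le_lieStabilizer)
  exact ((hle hg) M hM).1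

/-- **`[Lie(G), 𝔤_V] ⊆ 𝔤_V`** (the differential of the adjoint action, Springer 4.4.15).
[folklore] -/
theorem mul_sub_mul_mem_lie_of_mem_lieAlgebraGL {A : 𝕄} (hA : A ∈ lieAlgebraGL D.G) {M : 𝕄}
    (hM : M ∈ D.lie) : A * M - M * A ∈ D.lie :=
  lie_mem_of_forall_conj_mem (fun _ hg _ hM => D.conj_mem_lie hg hM) hA hM

/-! ### `G` is block diagonal; the trace relations on `Lie(G)` -/

/-- **`exp (x E_α)` is block diagonal with blocks `exp (x E_{α,j})`.** [folklore] -/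
lemma exp_smul_E (i : ι) (x : k) : IsNilpotent.exp (x • D.E i) =
    Matrix.blockDiagonal' fun j => IsNilpotent.exp (x • (D.blk j).E i) := by
  obtain ⟨N, hN⟩ := D.isNilpotent_E i
  have hNj : ∀ j, (x • (D.blk j).E i) ^ N = 0 := fun j => by
    have h := congrArg (fun M : 𝕄 => Matrix.blockDiag' M j) hN
    simp only [E_pow, Matrix.blockDiag'_blockDiagonal', Matrix.blockDiag'_zero, Pi.zero_apply]
      at h
    rw [smul_pow, h, smul_zero]
  have hNx : (x • D.E i) ^ N = 0 := by rw [smul_pow, hN, smul_zero]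
  rw [IsNilpotent.exp_eq_sum hNx]
  have hrhs : (Matrix.blockDiagonal' fun j => IsNilpotent.exp (x • (D.blk j).E i)) =
      Matrix.blockDiagonal' fun j => ∑ r ∈ Finset.range N,
        (r.factorial : ℚ)⁻¹ • (x • (D.blk j).E i) ^ r := by
    congr 1; funext j; rw [IsNilpotent.exp_eq_sum (hNj j)]
  rw [hrhs]
  ext a c
  rw [Matrix.sum_apply, Matrix.blockDiagonal'_apply]
  split_ifs with h
  · rcases a with ⟨j, a⟩
    rcases c with ⟨j', c⟩
    cases h
    simp only [Matrix.sum_apply, Matrix.smul_apply, smul_pow, E_pow]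
    refine Finset.sum_congr rfl fun r _ => ?_
    rw [Matrix.blockDiagonal'_apply_eq]
    rfl
  · refine Finset.sum_eq_zero fun r _ => ?_
    rw [Matrix.smul_apply, smul_pow, Matrix.smul_apply, E_pow,
      Matrix.blockDiagonal'_apply_ne _ _ _ h, smul_zero, smul_zero]

/-- `U_α` is block diagonal. [folklore] -/
lemma U_le_blockDiagSubgroup (i : ι) : D.U i ≤ blockDiagSubgroup := by
  rintro _ ⟨x, rfl⟩
  refine ⟨?_, ?_⟩
  · rw [coe_expHom_apply, D.exp_smul_E]; exact isBlockDiag_blockDiagonal' _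
  · rw [← map_inv, coe_expHom_apply, D.exp_smul_E]; exact isBlockDiag_blockDiagonal' _

/-- **`G` consists of block-diagonal matrices.** [folklore] -/
theorem G_le_blockDiagSubgroup : D.G ≤ blockDiagSubgroup :=
  sup_le D.T_le_blockDiagSubgroup (iSup_le D.U_le_blockDiagSubgroup)

/-- Entries of elements of `G` between different blocks vanish. [folklore] -/
lemma apply_of_fst_ne {g : GL (Σ j, mb j) k} (hg : g ∈ D.G) {x y : Σ j, mb j} (h : x.1 ≠ y.1) :
    (g : 𝕄) x y = 0 :=
  (D.G_le_blockDiagSubgroup hg).1 x y h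

/-- **`Lie(G)` consists of block-diagonal matrices** (the coordinates between different blocks
vanish on `G`). [folklore] -/
theorem isBlockDiag_of_mem_lieAlgebraGL {A : 𝕄} (hA : A ∈ lieAlgebraGL D.G) : IsBlockDiag A := by
  intro x y h
  rw [mem_lieAlgebraGL_iff] at hA
  have hmem : (MvPolynomial.X (Sum.inl (x, y)) : MvPolynomial (GLCoord (Σ j, mb j)) k) ∈
      MvPolynomial.vanishingIdeal k (glCoordFun '' ((D.G : Subgroup (GL (Σ j, mb j) k)) :
        Set (GL (Σ j, mb j) k))) := by
    rw [MvPolynomial.mem_vanishingIdeal_iff]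
    rintro _ ⟨g, hg, rfl⟩
    rw [MvPolynomial.aeval_X, glCoordFun_inl, D.apply_of_fst_ne hg h]
  have h0 := hA _ hmem
  rwa [tangentDeriv_X] at h0

/-- **The block determinant character is trivial on `U_α`** (`det exp (x E) = 1` in each block).
[folklore] -/
lemma U_le_blockDetKer (v : J → ℤ) (i : ι) : D.U i ≤ blockDetKer v := by
  rintro _ ⟨x, rfl⟩
  refine ⟨D.U_le_blockDiagSubgroup i ⟨x, rfl⟩, ?_⟩
  rw [blockDetChar_def, coe_expHom_apply, D.exp_smul_E, Matrix.blockDiag'_blockDiagonal']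
  simp only [det_exp_smul ((D.blk _).isNilpotent_E i), one_zpow, Finset.prod_const_one]

/-- `G` lies in the kernel of the block determinant character of every relation. [folklore] -/
lemma G_le_blockDetKer {v : J → ℤ} (hv : ∑ j, v j • D.blockWt j = 0) : D.G ≤ blockDetKer v :=
  sup_le (D.T_le_blockDetKer hv) (iSup_le (D.U_le_blockDetKer v))

/-- **The relation polynomial vanishes on `G`.** [folklore] -/
lemma blockDetRelPoly_mem_vanishingIdeal {v : J → ℤ} (hv : ∑ j, v j • D.blockWt j = 0) :
    blockDetRelPoly (k := k) (mb := mb) v ∈ MvPolynomial.vanishingIdeal k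
      (glCoordFun '' ((D.G : Subgroup (GL (Σ j, mb j) k)) : Set (GL (Σ j, mb j) k))) := by
  rw [MvPolynomial.mem_vanishingIdeal_iff]
  rintro _ ⟨g, hg, rfl⟩
  exact eval_blockDetRelPoly_eq_zero (D.G_le_blockDetKer hv hg)

/-- **The trace relations on `Lie(G)`**: for every integer relation `∑ v_j w_j = 0` among the block
weight sums and every `A ∈ Lie(G)`, `∑_j v_j tr (A|_{V_j}) = 0` (the differential of the trivial
character `∏ det_j ^ {v_j}` of `G`). [folklore] -/
theorem sum_trace_blockDiag_eq_zero {A : 𝕄} (hA : A ∈ lieAlgebraGL D.G) {v : J → ℤ}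
    (hv : ∑ j, v j • D.blockWt j = 0) :
    ∑ j, (v j : k) * Matrix.trace (Matrix.blockDiag' A j) = 0 := by
  rw [mem_lieAlgebraGL_iff] at hA
  have h := hA _ (D.blockDetRelPoly_mem_vanishingIdeal hv)
  rw [blockDetRelPoly, tangentDeriv_sub,
    (tangentDeriv_prod_pow_of_eval_one Finset.univ _ eval_one_blockDetPoly _ A).2,
    (tangentDeriv_prod_pow_of_eval_one Finset.univ _ eval_one_blockDetPoly _ A).2,
    ← Finset.sum_sub_distrib] at h
  rw [← h]
  refine Finset.sum_congr rfl fun j _ => ?_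
  rw [tangentDeriv_blockDetPoly, ← sub_mul, ← Int.cast_natCast,
    ← Int.cast_natCast (R := k) (-v j).toNat, ← Int.cast_sub, toNat_sub_toNat_neg_eq]

end Group

end RootRep

end Literature.NumberTheory.Automorphic
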